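import Summits.BirchSwinnertonDyer.BirchSwinnertonDyer.Theses.CumulativeHeegnerLeopoldt
import Summits.BirchSwinnertonDyer.BirchSwinnertonDyer.Theorems.CumulativeHeegnerLeopoldtEisensteinCharacterInvariantsAtThreeLocThree
import Summits.BirchSwinnertonDyer.BirchSwinnertonDyer.Theorems.CumulativeHeegnerLeopoldtEisensteinCharacterInvariantsAtThreeAlgSplit
import Summits.BirchSwinnertonDyer.BirchSwinnertonDyer.Theorems.CumulativeHeegnerLeopoldtEisensteinCharacterInvariantsAtThreeRamifiedSplit
import Summits.BirchSwinnertonDyer.BirchSwinnertonDyer.Theorems.CumulativeHeegnerLeopoldtEisensteinCharacterInvariantsAtThreeRamifiedResidualOfPrint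
import Summits.BirchSwinnertonDyer.BirchSwinnertonDyer.Theorems.CumulativeHeegnerLeopoldtEisensteinCharacterInvariantsAtThreeCharacterCutCoreOfPrint
import Summits.BirchSwinnertonDyer.BirchSwinnertonDyer.Theorems.CumulativeHeegnerLeopoldtEisensteinCharacterInvariantsAtThreeAlgLambdaOfCGLS
import HarnessLib

/-!
# Route `CumulativeHeegnerLeopoldt`, crux K2-odd `EisensteinCharacterInvariantsAtThreeOdd` (stmt-BirchSwinnertonDyer-23970) BY NAME, CLOSED MODULO
# six PUBLISHED named facts (CGLS 2022 Prop. 1.2.5 module clause, Cor. 1.2.6 (i), (ii), Thm. 2.1.2, Thm. 1.2.2+(2.16) ω-partner, Thm. 1.2.2 φ-half)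
# and ONE research statement (stub AN = crux stmt-BirchSwinnertonDyer-24040 `EisensteinCongruenceCoreAtThree`, taken as a HYPOTHESIS) — line `birth`
# v11's composition with its PRINT stub ALG-PRINT cut from 7 to 3 conjuncts (helper, `--supports stmt-BirchSwinnertonDyer-23970`)

Prover `leafhand-bsd-cumulativeheegnerl-1` g0 (cell `bsd-eis`). The registered skeleton (line `birth` v11, 76d2d6d28fe42776) concludes the crux BY NAME
from three sorried stubs: ALG-PRINT (7 named facts), AN (research, = crux 24040 verbatim), KR-PRINT (3 named facts). With this seat's
`EisensteinCharacterInvariantsAtThreeAlgLambdaOfCGLS.stub_algLambda_ofCGLS` (ALG ⟸ CGLS Prop. 1.2.5 module clause ∧ Cor. 1.2.6 (i) ∧ (ii); Greenberg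
2016 / 2006 fed by tree theorems) the same composition runs on SIX named facts + AN. THIS FILE records it as ONE theorem whose conclusion is the route
decl `Summit.BirchSwinnertonDyer.BirchSwinnertonDyer.Theses.CumulativeHeegnerLeopoldt.EisensteinCharacterInvariantsAtThreeOdd` LITERALLY and whose
hypotheses are exactly: `prop125_characterGrSelmerDual_torsion_muZero_dim`, `cor126_residualCharacter_globalLift`, `cor126_residualCharacter_localSurjective`,
`thm212_exists_isKatzLFunction`, `thm122_fe_omegaPartner_charGrDual_torsion_muZero_lambda_eq`, `thm122_charGrDual_torsion_muZero_firstUnit_lambda_eq`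
(all PUBLISHED, CGLS 2022 / Rubin 1991 / Hida 2010 / Katz 1978, typed as `Prop`s) and `hAN` = the registered signature of `stub_anCongruenceCore` VERBATIM
(the Λ-adic Eisenstein congruence core at `27 ∣ N` — NOT PRINTED; crux item 24040; a hypothesis here, not a Literature fact).

Composition = the skeleton's, verbatim: [TOR]/[LOC₃] tree theorems; P ⟸ Prop. 1.2.5 (`TeichmullerPairUnramifiedAtMult.prop14_residualCharacterSelmer_finite_of_fact`); ALG ⟸ 3 CGLS facts (this seat);
BRr ⟸ P ∧ KR-PRINT (ii) (`…RamifiedResidual.ramifiedResidualFinite_of_print`, `…BranchesOfPrint.ramifiedBranchLambda_of_print`,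
`…RamifiedSplit.ramifiedBranch_of_residualFinite_of_lambda`); the core cut `…CharacterCutCoreOfPrint.eisensteinCharacterInvariantsAtThree_odd_of_print_of_characterCutCore_of_print`
with [BR𝟙] from KR-PRINT (iii) and F1b = KR-PRINT (i) at `p = 3`.

INPUT LEDGER of crux 23970 after this file: {CGLS 2022 Prop. 1.2.5 (module clause), Cor. 1.2.6 (i), Cor. 1.2.6 (ii), Thm. 2.1.2, Thm. 1.2.2 (+ Rubin's
λ-clause, (2.16)) ×2} ∪ {AN = crux 24040}. Greenberg 2016 Props. 4.1.1 / 2.6.3, Greenberg 2006 Props. 4.1 / 3.2 and CGLS Prop. 14 as a separate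
input are GONE (tree theorems / ⟸ Prop. 1.2.5).

HONEST FRAMING: a composition of tree theorems; CONDITIONAL BY NAME on six PUBLISHED facts and on the research statement AN (hypothesis `hAN`);
no definition, no named fact introduced, no `sorry`; the crux item stays OPEN (this is a `--supports` helper, not a closure; the gate records a
conditional result). BSD is not proved for any curve by any of this.
References: [CastellaGrossiLeeSkinner2022] Prop. 1.2.5, Cor. 1.2.6, Prop. 14, Thms. 1.2.2, 1.5.1, 2.1.2, 2.2.1–2.2.2 with (2.16); [Rubin1991]; [Hida2010MuInvariant];
[KellerYin2024] Thms. 1.4.1, 2.2.2; [GreenbergVatsal2000] §2; [MilneADT2006] I Thms. 4.10 (a), 5.1; tree: the v11 skeleton's imports and this seat's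
`…AlgLambdaOfCGLS`.
-/

set_option linter.dupNamespace false
set_option autoImplicit false

noncomputable section

open scoped Classical

namespace Summit.BirchSwinnertonDyer.BirchSwinnertonDyer.Theorems.EisensteinCharacterInvariantsAtThreeOddOfCGLS

open PowerSeries WeierstrassCurve NumberField IsDedekindDomain Field
  Literature.NumberTheory.EllipticCurves Literature.NumberTheory.EllipticCurves.ModularForms
  Literature.NumberTheory.EllipticCurves.Rank1Residual
  Literature.NumberTheory.EllipticCurves.KellerYin2024
  Literature.NumberTheory.GaloisRepresentations
  Literature.NumberTheory.EllipticCurves.CastellaGrossiLeeSkinner2022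
  Summit.BirchSwinnertonDyer.Rank1Residual
  Summit.BirchSwinnertonDyer.Rank1Residual.X1.KellerYinMuLambdaSplit
  Summit.BirchSwinnertonDyer.BirchSwinnertonDyer.Theorems

/-- **Crux K2-odd `EisensteinCharacterInvariantsAtThreeOdd` (item 23970) BY NAME, modulo six PUBLISHED named facts and the research statement AN
(crux 24040, hypothesis `hAN`, registered stub signature VERBATIM)** — line `birth` v11's composition with ALG fed by this seat's Greenberg-free
`stub_algLambda_ofCGLS`. CONDITIONAL; the item stays open. [cite: CastellaGrossiLeeSkinner2022, Prop. 1.2.5, Cor. 1.2.6, Thms. 1.2.2, 1.5.1, 2.1.2, (2.16)]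
[cite: KellerYin2024, Thm. 1.4.1, Thm. 2.2.2] -/
theorem eisensteinCharacterInvariantsAtThreeOdd_of_print_of_anCongruenceCore
    (hprop125 : prop125_characterGrSelmerDual_torsion_muZero_dim)
    (hlift : cor126_residualCharacter_globalLift) (hlocal : cor126_residualCharacter_localSurjective)
    (h212 : thm212_exists_isKatzLFunction)
    (hfe : thm122_fe_omegaPartner_charGrDual_torsion_muZero_lambda_eq)
    (hchar : thm122_charGrDual_torsion_muZero_firstUnit_lambda_eq)
    (hAN : ∀ (W : WeierstrassCurve ℚ) [W.IsElliptic] [W.IsGloballyMinimal] (N : ℕ) [NeZero N] (K : Type) [Field K] [NumberField K] (Dt : Literature.NumberTheory.EllipticCurves.ModularForms.ModularParametrizationData W N), Summit.BirchSwinnertonDyer.Rank1Residual.Additive.ClassO6 W 3 → Literature.NumberTheory.EllipticCurves.Rank1Residual.Red W 3 → (∃ Φ : AddSubgroup (WeierstrassCurve.geomTorsion W ((3 : ℕ) : ℤ)), Literature.NumberTheory.EllipticCurves.Rank1Residual.IsRationalLine W 3 Φ ∧ ∀ (v : IsDedekindDomain.HeightOneSpectrum (NumberField.RingOfIntegers ℚ)),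 ((3 : ℕ) : NumberField.RingOfIntegers ℚ) ∈ v.asIdeal → ∀ 𝔓 ∈ v.primesAbove, ¬ (∀ g ∈ 𝔓.decompositionSubgroup (Field.absoluteGaloisGroup ℚ), ∀ P ∈ Φ, g • P = P) ∧ ¬ (∀ g ∈ 𝔓.decompositionSubgroup (Field.absoluteGaloisGroup ℚ), ∀ P : WeierstrassCurve.geomTorsion W ((3 : ℕ) : ℤ), g • P - P ∈ Φ)) → W.analyticRank = 1 → W.conductorNorm ℤ = N → Literature.NumberTheory.EllipticCurves.IsImaginaryQuadratic K → Literature.NumberTheory.EllipticCurves.SatisfiesHeegnerHypothesis N K → Odd (NumberField.discr K) → ∀ (κ : Literature.NumberTheory.EllipticCurves.ZpExtension K 3), κ.IsAnticyclotomic → ∀ (γ : Field.absoluteGaloisGroup K) [Fact (κ.IsTopGenerator γ)] (𝔭 : IsDedekindDomain.HeightOneSpectrum (NumberField.RingOfIntegers K)), ((3 : ℕ) : NumberField.RingOfIntegers K) ∈ 𝔭.asIdeal → 𝔭.asIdeal.ramificationIdx (NumberField.RingOfIntegers ℚ) = 1 → 𝔭.asIdeal.inertiaDeg (NumberField.RingOfIntegers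 ℚ) = 1 → ∀ (𝔭' : IsDedekindDomain.HeightOneSpectrum (NumberField.RingOfIntegers K)), ((3 : ℕ) : NumberField.RingOfIntegers K) ∈ 𝔭'.asIdeal → 𝔭' ≠ 𝔭 → ∀ (ι' : PadicAlgCl 3 ≃+* ℂ), Summit.BirchSwinnertonDyer.BirchSwinnertonDyer.Theorems.SchneiderFree.BranchInducesPrime 3 ι' 𝔭 → ∀ (ΩK : ℂ) (Ωp : ℂ_[3]) (L : Literature.NumberTheory.EllipticCurves.UnrSeries 3), ΩK ≠ 0 → Ωp ≠ 0 → Literature.NumberTheory.EllipticCurves.IsBDPLFunction ι' 𝔭 κ γ Dt.f ΩK Ωp L → ∀ (θsub θquot : FramedGaloisRep ℚ (padicCoeffIntegers (∅ : Set (PadicAlgCl 3))) 1), Literature.NumberTheory.EllipticCurves.KellerYin2024.IsResidualPairOver (W.baseChange K) 3 (θsub.restrictField K) (θquot.restrictField K) → ∀ (θunr : FramedGaloisRep ℚ (padicCoeffIntegers (∅ : Set (PadicAlgCl 3))) 1), (θunr = θsub ∨ θunr = θquot) → (∀ u : IsDedekindDomain.HeightOneSpectrum (NumberField.RingOfIntegers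 ℚ), ((3 : ℕ) : NumberField.RingOfIntegers ℚ) ∈ u.asIdeal → θunr.IsUnramifiedAt u) → ∀ (Sf : Finset (IsDedekindDomain.HeightOneSpectrum (NumberField.RingOfIntegers K))), (∀ w : IsDedekindDomain.HeightOneSpectrum (NumberField.RingOfIntegers K), w ∈ Sf ↔ ((W.conductorNorm ℤ : ℤ) : NumberField.RingOfIntegers K) ∈ w.asIdeal) → ∀ (θK : HeckeCharacter K), Literature.NumberTheory.EllipticCurves.KellerYin2024.IsHeckeCharOf ι' (θunr.restrictField K) θK → ∀ (Cbar : Finset (IsDedekindDomain.HeightOneSpectrum (NumberField.RingOfIntegers K))), (∀ u ∈ Cbar, ¬ θK.IsUnramifiedAt u) → ∀ (ΩK' : ℂ) (Ωp' : (Literature.NumberTheory.EllipticCurves.unrIntegers 3)ˣ) (Lφ : Literature.NumberTheory.EllipticCurves.UnrSeries 3), ΩK' ≠ 0 → Literature.NumberTheory.EllipticCurves.CastellaGrossiLeeSkinner2022.IsKatzLFunction ι' 𝔭 𝔭' Cbar κ γ θK ΩK' ((Ωp' : Literature.NumberTheory.EllipticCurves.unrIntegers 3) : ℂ_[3]) Lφ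 → ∀ nφ : ℕ, Literature.NumberTheory.EllipticCurves.KellerYin2024.FirstUnitCoeffAt Lφ nφ → ∃ n : ℕ, Literature.NumberTheory.EllipticCurves.KellerYin2024.FirstUnitCoeffAt L n ∧ n + ∑ w ∈ Sf, Literature.NumberTheory.EllipticCurves.KellerYin2024.curveLocalLambda κ (W.baseChange K) w = 2 * nφ + ∑ w ∈ Sf, (Literature.NumberTheory.EllipticCurves.KellerYin2024.charLocalLambda (∅ : Set (PadicAlgCl 3)) κ (θsub.restrictField K) w + Literature.NumberTheory.EllipticCurves.KellerYin2024.charLocalLambda (∅ : Set (PadicAlgCl 3)) κ (θquot.restrictField K) w)) :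
    Summit.BirchSwinnertonDyer.BirchSwinnertonDyer.Theses.CumulativeHeegnerLeopoldt.EisensteinCharacterInvariantsAtThreeOdd :=
  haveI : Fact (Nat.Prime 3) := ⟨Nat.prime_three⟩
  EisensteinCharacterInvariantsAtThreeCharacterCutCoreOfPrint.eisensteinCharacterInvariantsAtThree_odd_of_print_of_characterCutCore_of_print
    (TeichmullerPairUnramifiedAtMult.prop14_residualCharacterSelmer_finite_of_fact hprop125)
    EisensteinCharacterInvariantsAtThreeLocThree.isUnramifiedAt_three_sub_or_quot
    (EisensteinCharacterInvariantsAtThreeAlgLambdaOfCGLS.stub_algLambda_ofCGLS hprop125 hlift hlocal) hAN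
    (EisensteinCharacterInvariantsAtThreeRamifiedSplit.ramifiedBranch_of_residualFinite_of_lambda
      (EisensteinCharacterInvariantsAtThreeRamifiedResidual.ramifiedResidualFinite_of_print
        (TeichmullerPairUnramifiedAtMult.prop14_residualCharacterSelmer_finite_of_fact hprop125))
      (EisensteinCharacterInvariantsAtThreeBranchesOfPrint.ramifiedBranchLambda_of_print hfe))
    hchar (h212 3)

end Summit.BirchSwinnertonDyer.BirchSwinnertonDyer.Theorems.EisensteinCharacterInvariantsAtThreeOddOfCGLS

end
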